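import Summits.HodgeConjecture.CorCM.IrreducibleOddWeightsIsotypicCellsIso
import HarnessLib

/-!
# Isotypic cells, III: COEFFICIENT CONTAINERS — the cells `Θ_y(A) = {g ↦ a(g·y)}` of a stable irreducible `A ≤ ℚ^{Y}`
# are left-irreducible, a cell isomorphism forces a module isomorphism, and the containers of NON-ISOMORPHIC
# constituents are INDEPENDENT in `ℚ^G`

COR-CM (cell `pub-hodgecm2`, binder seat `b16` gen 70, count-neutral claim ISOTYPIC SPLITTING OF THE DEFECT, file I3 —
abstract `G`-set level, in the lane's own language; theorems only, no definition, no named fact, no `sorry`).  NEW as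
stated, hence under `Summits/`.  HONEST FRAMING: linear algebra of translates of functions on finite `G`-sets, feeding
files I1/I2 (`IrreducibleOddWeightsIsotypicCells{,Iso}`) with the lane's three operator families; consequences for the
Kubota–Dodson rank follow in files I4 ff.; `HC_CM` is neither used nor asserted.

SETTING.  `G` acts on finite sets `Y₀, Y₁`.  For `y ∈ Y` the COEFFICIENT MAP `Θ_y : ℚ^{Y} → ℚ^G`, `Θ_y f = (g ↦ f(g·y))`
(Mathlib's `LinearMap.funLeft ℚ ℚ (· • y)`), intertwines the translates `f ↦ f(k·)` with the LEFT translations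
`c ↦ c(k·)`.  For a stable `A ≤ ℚ^{Y}` the CELL at `y` is `Θ_y(A)` and the CONTAINER is `𝒞_A = Σ_y Θ_y(A)`; the shadow-
coefficient space `S(a) = span{Θ_y a : y}` of every `a ∈ A` lies in `𝒞_A`.

* §1 `Θ_y` intertwines; cells of a stable `A` are left-stable; for `A` irreducible each cell is LEFT-IRREDUCIBLE and
  `Θ_y` is injective on `A` unless the cell is `0`; `S(a) ≤ 𝒞_A`.
* §2 **A CELL ISOMORPHISM FORCES A MODULE EMBEDDING** (`exists_map_of_cell_iso`): `A ≤ ℚ^{Y₀}`, `B ≤ ℚ^{Y₁}` stable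
  irreducible, `Θ_{y₀}(A) ≠ 0`, and a linear `P`, left-equivariant and injective on `Θ_{y₀}(A)` with
  `P(Θ_{y₀}(A)) ⊆ Θ_{y₁}(B)` ⟹ an equivariant `L : ℚ^{Y₀} → ℚ^{Y₁}`, injective on `A`, with `L(A) ⊆ B`
  (`L = Θ_{y₁}⁻¹ ∘ P ∘ Θ_{y₀}` on `A`).
* §3 **CONTAINERS OF NON-ISOMORPHIC CONSTITUENTS ARE INDEPENDENT**
  (`iSup_container_inf_iSup_container_eq_bot`): two CLASSES of stable irreducible constituents — `A⁰_j ≤ ℚ^{Y₀}`,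
  `A¹_j ≤ ℚ^{Y₁}` on one side, `B⁰_k ≤ ℚ^{Y₀}`, `B¹_k ≤ ℚ^{Y₁}` on the other — such that NO non-zero constituent of the
  first class embeds equivariantly into one of the second ⟹ **`(Σ 𝒞_{A⁰_j} + Σ 𝒞_{A¹_j}) ⊓ (Σ 𝒞_{B⁰_k} + Σ 𝒞_{B¹_k}) = 0`**
  (file I2's cross-type independence for the left cells, transported by §2).

## References

* [Serre1977] J.-P. Serre, *Linear Representations of Finite Groups*, GTM 42, §2.2, §2.6 (canonical decomposition: the
  isotypic components and their matrix coefficients).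
* [Lang2002] S. Lang, *Algebra*, 3rd ed., XVII §1 Prop. 1.1, XVII §3.
* [CurtisReiner1962] C. W. Curtis, I. Reiner, *Representation Theory of Finite Groups and Associative Algebras*, §27.
-/

set_option autoImplicit false

noncomputable section

open scoped BigOperators Classical

universe u u' u'' u''' v' v'' w

namespace Summit.HodgeConjecture.CorCM.IrrOdd

variable {G : Type w} [Group G] {Y₀ : Type v'} [MulAction G Y₀] [Fintype Y₀]
  {Y₁ : Type v''} [MulAction G Y₁] [Fintype Y₁]

/-! ### §1 Coefficient maps, cells, containers -/

omit [Fintype Y₀] in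
/-- `Θ_y` INTERTWINES the translates with the left translations: `Θ_y(f(k·)) = (g ↦ (Θ_y f)(k g))`.
[cite: Serre1977, §2.2] -/
theorem funLeft_orbit_translate (y : Y₀) (k : G) (f : Y₀ → ℚ) :
    LinearMap.funLeft ℚ ℚ (fun g : G => g • y) (fun x => f (k • x)) =
      fun g => LinearMap.funLeft ℚ ℚ (fun g : G => g • y) f (k * g) := by
  funext g
  simp [LinearMap.funLeft_apply, mul_smul]

omit [Fintype Y₀] in
/-- Cells of a stable `A` are LEFT-STABLE. [cite: Serre1977, §2.2] -/
theorem map_funLeft_orbit_leftStable {A : Submodule ℚ (Y₀ → ℚ)}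
    (hAst : ∀ (k : G) (a : Y₀ → ℚ), a ∈ A → (fun y => a (k • y)) ∈ A) (y : Y₀) :
    ∀ (k : G) (c : G → ℚ), c ∈ A.map (LinearMap.funLeft ℚ ℚ (fun g : G => g • y)) →
      (fun g => c (k * g)) ∈ A.map (LinearMap.funLeft ℚ ℚ (fun g : G => g • y)) := by
  rintro k _ ⟨a, ha, rfl⟩
  exact ⟨fun x => a (k • x), hAst k a ha, funLeft_orbit_translate y k a⟩

omit [Fintype Y₀] in
/-- For `A` stable IRREDUCIBLE, `Θ_y` is injective on `A` or the cell `Θ_y(A)` is `0` (its kernel in `A` is stable).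
[cite: Serre1977, §2.2] -/
theorem funLeft_orbit_injOn_or_map_eq_bot {A : Submodule ℚ (Y₀ → ℚ)}
    (hAst : ∀ (k : G) (a : Y₀ → ℚ), a ∈ A → (fun y => a (k • y)) ∈ A)
    (hAirr : ∀ W : Submodule ℚ (Y₀ → ℚ), W ≤ A → W ≠ ⊥ →
      (∀ (k : G) (f : Y₀ → ℚ), f ∈ W → (fun y => f (k • y)) ∈ W) → W = A) (y : Y₀) :
    (∀ a ∈ A, LinearMap.funLeft ℚ ℚ (fun g : G => g • y) a = 0 → a = 0) ∨
      A.map (LinearMap.funLeft ℚ ℚ (fun g : G => g • y)) = ⊥ := by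
  by_cases hK : LinearMap.ker (LinearMap.funLeft ℚ ℚ (fun g : G => g • y)) ⊓ A = ⊥
  · left
    intro a ha h0
    have hmem : a ∈ LinearMap.ker (LinearMap.funLeft ℚ ℚ (fun g : G => g • y)) ⊓ A := ⟨h0, ha⟩
    rw [hK] at hmem
    exact (Submodule.mem_bot ℚ).1 hmem
  · right
    have hKA : LinearMap.ker (LinearMap.funLeft ℚ ℚ (fun g : G => g • y)) ⊓ A = A :=
      hAirr _ inf_le_right hK (fun k f hf => ⟨by
        have h0 : LinearMap.funLeft ℚ ℚ (fun g : G => g • y) f = 0 := hf.1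
        show LinearMap.funLeft ℚ ℚ (fun g : G => g • y) (fun x => f (k • x)) = 0
        rw [funLeft_orbit_translate, h0]
        rfl, hAst k f hf.2⟩)
    rw [eq_bot_iff]
    rintro _ ⟨a, ha, rfl⟩
    have ha' : a ∈ LinearMap.ker (LinearMap.funLeft ℚ ℚ (fun g : G => g • y)) ⊓ A := by rw [hKA]; exact ha
    rw [Submodule.mem_bot]
    exact ha'.1

omit [Fintype Y₀] in
/-- **CELLS OF AN IRREDUCIBLE ARE LEFT-IRREDUCIBLE**: for `A` stable irreducible, every non-zero left-stable
`W ≤ Θ_y(A)` is `Θ_y(A)` (its preimage in `A` is stable and non-zero). [cite: Serre1977, §2.2 and §2.6] -/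
theorem map_funLeft_orbit_leftIrreducible {A : Submodule ℚ (Y₀ → ℚ)}
    (hAst : ∀ (k : G) (a : Y₀ → ℚ), a ∈ A → (fun y => a (k • y)) ∈ A)
    (hAirr : ∀ W : Submodule ℚ (Y₀ → ℚ), W ≤ A → W ≠ ⊥ →
      (∀ (k : G) (f : Y₀ → ℚ), f ∈ W → (fun y => f (k • y)) ∈ W) → W = A) (y : Y₀) :
    ∀ W : Submodule ℚ (G → ℚ), W ≤ A.map (LinearMap.funLeft ℚ ℚ (fun g : G => g • y)) → W ≠ ⊥ →
      (∀ (k : G) (c : G → ℚ), c ∈ W → (fun g => c (k * g)) ∈ W) →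
      W = A.map (LinearMap.funLeft ℚ ℚ (fun g : G => g • y)) := by
  intro W hW hW0 hWst
  set Θ := LinearMap.funLeft ℚ ℚ (fun g : G => g • y) with hΘ
  -- the preimage of `W` in `A` is stable and non-zero, hence `A`
  have hpre : W.comap Θ ⊓ A = A := by
    refine hAirr _ inf_le_right (fun h => hW0 ?_) (fun k f hf => ⟨?_, hAst k f hf.2⟩)
    · rw [eq_bot_iff]
      intro c hc
      obtain ⟨a, ha, rfl⟩ := Submodule.mem_map.1 (hW hc)
      have hmem : a ∈ W.comap Θ ⊓ A := ⟨hc, ha⟩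
      rw [h, Submodule.mem_bot] at hmem
      rw [hmem, map_zero]
      exact Submodule.zero_mem _
    · show Θ (fun x => f (k • x)) ∈ W
      rw [hΘ, funLeft_orbit_translate]
      exact hWst k _ hf.1
  refine le_antisymm hW ?_
  rintro _ ⟨a, ha, rfl⟩
  have ha' : a ∈ W.comap Θ ⊓ A := by rw [hpre]; exact ha
  exact ha'.1

omit [Fintype Y₀] in
/-- **`S(a) ≤ 𝒞_A`**: the shadow-coefficient space of `a ∈ A` lies in the container `Σ_y Θ_y(A)`.
[cite: Serre1977, §2.6] -/
theorem span_shadowCoeff_le_iSup_map_funLeft_orbit {A : Submodule ℚ (Y₀ → ℚ)} {a : Y₀ → ℚ} (ha : a ∈ A) :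
    Submodule.span ℚ (Set.range fun y : Y₀ => fun g : G => a (g • y)) ≤
      ⨆ y : Y₀, A.map (LinearMap.funLeft ℚ ℚ (fun g : G => g • y)) := by
  rw [Submodule.span_le]
  rintro _ ⟨y, rfl⟩
  exact Submodule.mem_iSup_of_mem y ⟨a, ha, rfl⟩

/-! ### §2 A cell isomorphism forces a module embedding -/

omit [Fintype Y₀] [Fintype Y₁] in
/-- **A CELL ISOMORPHISM FORCES A MODULE EMBEDDING.**  `A ≤ ℚ^{Y₀}`, `B ≤ ℚ^{Y₁}` stable irreducible; `Θ_{y₀}(A) ≠ 0`;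
`P : ℚ^G → ℚ^G` linear, mapping `Θ_{y₀}(A)` into `Θ_{y₁}(B)`, injective on `Θ_{y₀}(A)` and commuting there with the
left translations.  Then some linear `L : ℚ^{Y₀} → ℚ^{Y₁}` maps `A` into `B`, is injective on `A` and EQUIVARIANT on `A`
(`L = Θ_{y₁}⁻¹ ∘ P ∘ Θ_{y₀}`; `Θ_{y₁}` is injective on `B` because its cell is non-zero).  With both irreducible, `L` is
an isomorphism `A ≅ B`. [cite: Serre1977, §2.2] [cite: Lang2002, XVII §1 Prop. 1.1] -/
theorem exists_map_of_cell_iso {A : Submodule ℚ (Y₀ → ℚ)} {B : Submodule ℚ (Y₁ → ℚ)}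
    (hAst : ∀ (k : G) (a : Y₀ → ℚ), a ∈ A → (fun y => a (k • y)) ∈ A)
    (hAirr : ∀ W : Submodule ℚ (Y₀ → ℚ), W ≤ A → W ≠ ⊥ →
      (∀ (k : G) (f : Y₀ → ℚ), f ∈ W → (fun y => f (k • y)) ∈ W) → W = A)
    (hBst : ∀ (k : G) (b : Y₁ → ℚ), b ∈ B → (fun y => b (k • y)) ∈ B)
    (hBirr : ∀ W : Submodule ℚ (Y₁ → ℚ), W ≤ B → W ≠ ⊥ →
      (∀ (k : G) (f : Y₁ → ℚ), f ∈ W → (fun y => f (k • y)) ∈ W) → W = B)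
    (y₀ : Y₀) (y₁ : Y₁) (hne : A.map (LinearMap.funLeft ℚ ℚ (fun g : G => g • y₀)) ≠ ⊥)
    (P : (G → ℚ) →ₗ[ℚ] (G → ℚ))
    (hP : ∀ c ∈ A.map (LinearMap.funLeft ℚ ℚ (fun g : G => g • y₀)),
      P c ∈ B.map (LinearMap.funLeft ℚ ℚ (fun g : G => g • y₁)))
    (hPinj : ∀ c ∈ A.map (LinearMap.funLeft ℚ ℚ (fun g : G => g • y₀)), P c = 0 → c = 0)
    (hPeq : ∀ (k : G) (c : G → ℚ), c ∈ A.map (LinearMap.funLeft ℚ ℚ (fun g : G => g • y₀)) →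
      P (fun g => c (k * g)) = fun g => P c (k * g)) :
    ∃ L : (Y₀ → ℚ) →ₗ[ℚ] (Y₁ → ℚ), (∀ a ∈ A, L a ∈ B) ∧ (∀ a ∈ A, L a = 0 → a = 0) ∧
      ∀ (k : G) (a : Y₀ → ℚ), a ∈ A → L (fun y => a (k • y)) = fun y => L a (k • y) := by
  set Θ₀ := LinearMap.funLeft ℚ ℚ (fun g : G => g • y₀) with hΘ₀
  set Θ₁ := LinearMap.funLeft ℚ ℚ (fun g : G => g • y₁) with hΘ₁
  -- `Θ₀` is injective on `A`, `Θ₁` is injective on `B` (both cells are non-zero)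
  have hinj₀ : ∀ a ∈ A, Θ₀ a = 0 → a = 0 := by
    rcases funLeft_orbit_injOn_or_map_eq_bot hAst hAirr y₀ with h | h
    · exact h
    · exact absurd h hne
  obtain ⟨a₁, ha₁A, ha₁0⟩ : ∃ a ∈ A, Θ₀ a ≠ 0 := by
    by_contra h
    push Not at h
    apply hne
    rw [eq_bot_iff]
    rintro _ ⟨a, ha, rfl⟩
    rw [Submodule.mem_bot]
    exact h a ha
  have hne₁ : B.map Θ₁ ≠ ⊥ := by
    intro h
    have hmem : P (Θ₀ a₁) ∈ B.map Θ₁ := hP _ ⟨a₁, ha₁A, rfl⟩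
    rw [h, Submodule.mem_bot] at hmem
    exact ha₁0 (hPinj _ ⟨a₁, ha₁A, rfl⟩ hmem)
  have hinj₁ : ∀ b ∈ B, Θ₁ b = 0 → b = 0 := by
    rcases funLeft_orbit_injOn_or_map_eq_bot hBst hBirr y₁ with h | h
    · exact h
    · exact absurd h hne₁
  -- invert `Θ₁|_B` on its range, which contains `P(Θ₀(A))`
  have hinj₁' : Function.Injective (Θ₁.domRestrict B) := by
    intro a b hab
    apply Subtype.ext
    have hsub : Θ₁ ((a : Y₁ → ℚ) - b) = 0 := by
      rw [map_sub, sub_eq_zero]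
      exact hab
    exact sub_eq_zero.1 (hinj₁ _ (B.sub_mem a.2 b.2) hsub)
  have hmem : ∀ a : A, (P ∘ₗ Θ₀).domRestrict A a ∈ LinearMap.range (Θ₁.domRestrict B) := fun a => by
    rw [LinearMap.range_domRestrict]
    exact hP _ ⟨a, a.2, rfl⟩
  obtain ⟨L, hL⟩ := LinearMap.exists_extend
    (B.subtype ∘ₗ (LinearEquiv.ofInjective (Θ₁.domRestrict B) hinj₁').symm.toLinearMap ∘ₗ
      LinearMap.codRestrict (LinearMap.range (Θ₁.domRestrict B)) ((P ∘ₗ Θ₀).domRestrict A) hmem)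
  -- on `A`: `L a ∈ B` and `Θ₁ (L a) = P (Θ₀ a)`
  have hLa : ∀ a ∈ A, L a ∈ B ∧ Θ₁ (L a) = P (Θ₀ a) := by
    intro a ha
    have h1 := LinearMap.congr_fun hL ⟨a, ha⟩
    simp only [LinearMap.coe_comp, Function.comp_apply, Submodule.coe_subtype, LinearEquiv.coe_coe] at h1
    refine ⟨by rw [h1]; exact Submodule.coe_mem _, ?_⟩
    have h2 := LinearEquiv.ofInjective_symm_apply (Θ₁.domRestrict B) (h := hinj₁')
      (LinearMap.codRestrict (LinearMap.range (Θ₁.domRestrict B)) ((P ∘ₗ Θ₀).domRestrict A) hmem ⟨a, ha⟩)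
    rw [LinearMap.domRestrict_apply] at h2
    rw [h1, h2]
    rfl
  refine ⟨L, fun a ha => (hLa a ha).1, fun a ha h0 => ?_, fun k a ha => ?_⟩
  · have h := (hLa a ha).2
    rw [h0, map_zero] at h
    exact hinj₀ a ha (hPinj _ ⟨a, ha, rfl⟩ h.symm)
  · -- both sides lie in `B` and have the same image under `Θ₁`
    have hak : (fun y => a (k • y)) ∈ A := hAst k a ha
    have hdiff := hinj₁ (L (fun y => a (k • y)) - fun y => L a (k • y))
      (B.sub_mem (hLa _ hak).1 (hBst k _ (hLa a ha).1)) (by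
        rw [map_sub, (hLa _ hak).2, hΘ₀, funLeft_orbit_translate, ← hΘ₀, hPeq k _ ⟨a, ha, rfl⟩,
          ← (hLa a ha).2, hΘ₁, ← funLeft_orbit_translate, sub_self])
    exact sub_eq_zero.1 hdiff

/-! ### §3 Containers of non-isomorphic constituents are independent -/

/-- **CONTAINERS OF NON-ISOMORPHIC CONSTITUENTS ARE INDEPENDENT.**  Two classes of stable irreducible constituents,
`A⁰_j ≤ ℚ^{Y₀}` (`j ∈ J₀`), `A¹_j ≤ ℚ^{Y₁}` (`j ∈ J₁`) and `B⁰_k ≤ ℚ^{Y₀}` (`k ∈ K₀`), `B¹_k ≤ ℚ^{Y₁}` (`k ∈ K₁`), such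
that NO non-zero `A`-constituent embeds equivariantly into a `B`-constituent (four families of hypotheses).  Then the
two CONTAINER SUMS meet trivially:
`(Σ_j 𝒞_{A⁰_j} ⊔ Σ_j 𝒞_{A¹_j}) ⊓ (Σ_k 𝒞_{B⁰_k} ⊔ Σ_k 𝒞_{B¹_k}) = 0`, `𝒞_A = Σ_y Θ_y(A)`.
[cite: Serre1977, §2.6] [cite: CurtisReiner1962, §27] -/
theorem iSup_container_inf_iSup_container_eq_bot {J₀ : Type u} {J₁ : Type u'} {K₀ : Type u''} {K₁ : Type u'''}
    [Fintype J₀] [Fintype J₁] [Fintype K₀] [Fintype K₁]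
    {A₀ : J₀ → Submodule ℚ (Y₀ → ℚ)} {A₁ : J₁ → Submodule ℚ (Y₁ → ℚ)}
    {B₀ : K₀ → Submodule ℚ (Y₀ → ℚ)} {B₁ : K₁ → Submodule ℚ (Y₁ → ℚ)}
    (hA₀st : ∀ (j : J₀) (k : G) (a : Y₀ → ℚ), a ∈ A₀ j → (fun y => a (k • y)) ∈ A₀ j)
    (hA₀irr : ∀ (j : J₀) (W : Submodule ℚ (Y₀ → ℚ)), W ≤ A₀ j → W ≠ ⊥ →
      (∀ (k : G) (f : Y₀ → ℚ), f ∈ W → (fun y => f (k • y)) ∈ W) → W = A₀ j)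
    (hA₁st : ∀ (j : J₁) (k : G) (a : Y₁ → ℚ), a ∈ A₁ j → (fun y => a (k • y)) ∈ A₁ j)
    (hA₁irr : ∀ (j : J₁) (W : Submodule ℚ (Y₁ → ℚ)), W ≤ A₁ j → W ≠ ⊥ →
      (∀ (k : G) (f : Y₁ → ℚ), f ∈ W → (fun y => f (k • y)) ∈ W) → W = A₁ j)
    (hB₀st : ∀ (j : K₀) (k : G) (a : Y₀ → ℚ), a ∈ B₀ j → (fun y => a (k • y)) ∈ B₀ j)
    (hB₀irr : ∀ (j : K₀) (W : Submodule ℚ (Y₀ → ℚ)), W ≤ B₀ j → W ≠ ⊥ →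
      (∀ (k : G) (f : Y₀ → ℚ), f ∈ W → (fun y => f (k • y)) ∈ W) → W = B₀ j)
    (hB₁st : ∀ (j : K₁) (k : G) (a : Y₁ → ℚ), a ∈ B₁ j → (fun y => a (k • y)) ∈ B₁ j)
    (hB₁irr : ∀ (j : K₁) (W : Submodule ℚ (Y₁ → ℚ)), W ≤ B₁ j → W ≠ ⊥ →
      (∀ (k : G) (f : Y₁ → ℚ), f ∈ W → (fun y => f (k • y)) ∈ W) → W = B₁ j)
    (h₀₀ : ∀ (j : J₀) (k : K₀) (L : (Y₀ → ℚ) →ₗ[ℚ] (Y₀ → ℚ)), A₀ j ≠ ⊥ → (∀ a ∈ A₀ j, L a ∈ B₀ k) →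
      (∀ a ∈ A₀ j, L a = 0 → a = 0) → (∀ (g : G) (a : Y₀ → ℚ), a ∈ A₀ j →
        L (fun y => a (g • y)) = fun y => L a (g • y)) → False)
    (h₀₁ : ∀ (j : J₀) (k : K₁) (L : (Y₀ → ℚ) →ₗ[ℚ] (Y₁ → ℚ)), A₀ j ≠ ⊥ → (∀ a ∈ A₀ j, L a ∈ B₁ k) →
      (∀ a ∈ A₀ j, L a = 0 → a = 0) → (∀ (g : G) (a : Y₀ → ℚ), a ∈ A₀ j →
        L (fun y => a (g • y)) = fun y => L a (g • y)) → False)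
    (h₁₀ : ∀ (j : J₁) (k : K₀) (L : (Y₁ → ℚ) →ₗ[ℚ] (Y₀ → ℚ)), A₁ j ≠ ⊥ → (∀ a ∈ A₁ j, L a ∈ B₀ k) →
      (∀ a ∈ A₁ j, L a = 0 → a = 0) → (∀ (g : G) (a : Y₁ → ℚ), a ∈ A₁ j →
        L (fun y => a (g • y)) = fun y => L a (g • y)) → False)
    (h₁₁ : ∀ (j : J₁) (k : K₁) (L : (Y₁ → ℚ) →ₗ[ℚ] (Y₁ → ℚ)), A₁ j ≠ ⊥ → (∀ a ∈ A₁ j, L a ∈ B₁ k) →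
      (∀ a ∈ A₁ j, L a = 0 → a = 0) → (∀ (g : G) (a : Y₁ → ℚ), a ∈ A₁ j →
        L (fun y => a (g • y)) = fun y => L a (g • y)) → False) :
    ((⨆ j, ⨆ y : Y₀, (A₀ j).map (LinearMap.funLeft ℚ ℚ (fun g : G => g • y))) ⊔
        ⨆ j, ⨆ y : Y₁, (A₁ j).map (LinearMap.funLeft ℚ ℚ (fun g : G => g • y))) ⊓
      ((⨆ k, ⨆ y : Y₀, (B₀ k).map (LinearMap.funLeft ℚ ℚ (fun g : G => g • y))) ⊔
        ⨆ k, ⨆ y : Y₁, (B₁ k).map (LinearMap.funLeft ℚ ℚ (fun g : G => g • y))) = ⊥ := by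
  -- index the left cells of each class by a sum type
  let N : (J₀ × Y₀) ⊕ (J₁ × Y₁) → Submodule ℚ (G → ℚ) := fun s => match s with
    | Sum.inl p => (A₀ p.1).map (LinearMap.funLeft ℚ ℚ (fun g : G => g • p.2))
    | Sum.inr p => (A₁ p.1).map (LinearMap.funLeft ℚ ℚ (fun g : G => g • p.2))
  let N' : (K₀ × Y₀) ⊕ (K₁ × Y₁) → Submodule ℚ (G → ℚ) := fun t => match t with
    | Sum.inl p => (B₀ p.1).map (LinearMap.funLeft ℚ ℚ (fun g : G => g • p.2))
    | Sum.inr p => (B₁ p.1).map (LinearMap.funLeft ℚ ℚ (fun g : G => g • p.2))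
  have hN : (⨆ s, N s) = (⨆ j, ⨆ y : Y₀, (A₀ j).map (LinearMap.funLeft ℚ ℚ (fun g : G => g • y))) ⊔
      ⨆ j, ⨆ y : Y₁, (A₁ j).map (LinearMap.funLeft ℚ ℚ (fun g : G => g • y)) := by
    rw [iSup_sum, iSup_prod, iSup_prod]
  have hN' : (⨆ t, N' t) = (⨆ k, ⨆ y : Y₀, (B₀ k).map (LinearMap.funLeft ℚ ℚ (fun g : G => g • y))) ⊔
      ⨆ k, ⨆ y : Y₁, (B₁ k).map (LinearMap.funLeft ℚ ℚ (fun g : G => g • y)) := by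
    rw [iSup_sum, iSup_prod, iSup_prod]
  rw [← hN, ← hN']
  -- the operator family: left translations
  let T : G → (G → ℚ) →ₗ[ℚ] (G → ℚ) := fun k => LinearMap.funLeft ℚ ℚ (fun g : G => k * g)
  have hT : ∀ (k : G) (c : G → ℚ), T k c = fun g => c (k * g) := fun k c => rfl
  haveI : ∀ s, FiniteDimensional ℚ (N s) := fun s => by
    rcases s with ⟨j, y⟩ | ⟨j, y⟩ <;> exact Module.Finite.map _ _
  haveI : ∀ t, FiniteDimensional ℚ (N' t) := fun t => by
    rcases t with ⟨k, y⟩ | ⟨k, y⟩ <;> exact Module.Finite.map _ _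
  refine iSup_inf_iSup_eq_bot_of_forall_not_iso T ?_ ?_ ?_ ?_ ?_
  · rintro (⟨j, y⟩ | ⟨j, y⟩) k c hc
    · exact map_funLeft_orbit_leftStable (hA₀st j) y k c hc
    · exact map_funLeft_orbit_leftStable (hA₁st j) y k c hc
  · rintro (⟨j, y⟩ | ⟨j, y⟩) W hW hW0 hWst
    · exact map_funLeft_orbit_leftIrreducible (hA₀st j) (hA₀irr j) y W hW hW0 (fun k c hc => hWst k c hc)
    · exact map_funLeft_orbit_leftIrreducible (hA₁st j) (hA₁irr j) y W hW hW0 (fun k c hc => hWst k c hc)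
  · rintro (⟨j, y⟩ | ⟨j, y⟩) k c hc
    · exact map_funLeft_orbit_leftStable (hB₀st j) y k c hc
    · exact map_funLeft_orbit_leftStable (hB₁st j) y k c hc
  · rintro (⟨j, y⟩ | ⟨j, y⟩) W hW hW0 hWst
    · exact map_funLeft_orbit_leftIrreducible (hB₀st j) (hB₀irr j) y W hW hW0 (fun k c hc => hWst k c hc)
    · exact map_funLeft_orbit_leftIrreducible (hB₁st j) (hB₁irr j) y W hW hW0 (fun k c hc => hWst k c hc)
  · -- a cell isomorphism would give a module embedding, excluded by hypothesis
    have hne_of : ∀ {Y : Type v'} [MulAction G Y] (C : Submodule ℚ (Y → ℚ)) (y : Y),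
        C.map (LinearMap.funLeft ℚ ℚ (fun g : G => g • y)) ≠ ⊥ → C ≠ ⊥ := by
      intro Y _ C y h hC
      apply h
      rw [hC, Submodule.map_bot]
    have hne_of' : ∀ {Y : Type v''} [MulAction G Y] (C : Submodule ℚ (Y → ℚ)) (y : Y),
        C.map (LinearMap.funLeft ℚ ℚ (fun g : G => g • y)) ≠ ⊥ → C ≠ ⊥ := by
      intro Y _ C y h hC
      apply h
      rw [hC, Submodule.map_bot]
    rintro (⟨j, y⟩ | ⟨j, y⟩) (⟨k, y'⟩ | ⟨k, y'⟩) hs P hP hPinj - hPeq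
    · obtain ⟨L, hLB, hLinj, hLeq⟩ := exists_map_of_cell_iso (hA₀st j) (hA₀irr j) (hB₀st k) (hB₀irr k) y y'
        hs P hP hPinj (fun g c hc => hPeq g c hc)
      exact h₀₀ j k L (hne_of _ y hs) hLB hLinj hLeq
    · obtain ⟨L, hLB, hLinj, hLeq⟩ := exists_map_of_cell_iso (hA₀st j) (hA₀irr j) (hB₁st k) (hB₁irr k) y y'
        hs P hP hPinj (fun g c hc => hPeq g c hc)
      exact h₀₁ j k L (hne_of _ y hs) hLB hLinj hLeq
    · obtain ⟨L, hLB, hLinj, hLeq⟩ := exists_map_of_cell_iso (hA₁st j) (hA₁irr j) (hB₀st k) (hB₀irr k) y y'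
        hs P hP hPinj (fun g c hc => hPeq g c hc)
      exact h₁₀ j k L (hne_of' _ y hs) hLB hLinj hLeq
    · obtain ⟨L, hLB, hLinj, hLeq⟩ := exists_map_of_cell_iso (hA₁st j) (hA₁irr j) (hB₁st k) (hB₁irr k) y y'
        hs P hP hPinj (fun g c hc => hPeq g c hc)
      exact h₁₁ j k L (hne_of' _ y hs) hLB hLinj hLeq

end Summit.HodgeConjecture.CorCM.IrrOdd

end
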